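import Summits.HubbardSuperconductivity.HubbardSuperconductivity.Theorems.MesoscopicPairOrder.Negative.LoadBearing
import Literature.MathematicalPhysics.QuantumLattice.HubbardHubbardModelEtaODLROProofs
import HarnessLib

/-!
# Crux `MesoscopicPairOrder` (item `stmt-HubbardSuperconductivity-7331`), line `SketchIdeator4`:
# η-annihilation is NOT a substitute for minimality

Negative lemma for the line's load-bearing stub `stub_etaCornerOrder`
(`Cruxes/MesoscopicPairOrder/Lines/SketchIdeator4.lean`): the stub asks for the crux body at some
`(U, δ)` of the η-corner `δ ∈ (1/3, 1/2)`, `U > 8(1-δ)/(3δ-1)`, for normalised sector GROUND STATES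
`ψ` with `η ψ = 0` (`η = etaLower torusStagger`). If "ground state in the sector" is weakened to "unit
vector in the sector" while the η clause is KEPT, the statement is FALSE at every `(U, δ)`: the
row-separated `↑/↓` occupation state of `Negative.LoadBearing` (every local pair `P_x` kills it) is
doublon-free, hence η-annihilated as well (`exists_unit_localKernel_state_eta`). So the η hypothesis
carries no pair order by itself; together with the lead's `cornerOrder_iff_etaCornerOrder` (the η
clause is dischargeable for ground states in the corner, stubs p124790/p125295/p125420) this makes the
η clause of the stub IDLE on both sides: any proof of the stub is a proof of the crux body in the
corner using minimality in full.

* `etaLower_mulVec_single_pairSet_eq_zero` — `η |A↑ B↓⟩ = 0` for disjoint `A, B` (no doublon);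
* `exists_unit_localKernel_state_eta` — the explicit unit kernel state of the sector `(2m, 0)`, killed
  by every `P_x` AND by `η`;
* `etaCornerBody_false_without_groundState` — the stub's signature with `IsGroundStateInSector`
  replaced by sector membership is false (over the whole range `δ ∈ (0, 1/2)`, a fortiori in the corner).

No definition is introduced. Yang, PRL 63 (1989) 2144 (η); Lieb, PRL 62 (1989) 1201 (sectors); folklore.
-/

noncomputable section

namespace Summit.HubbardSuperconductivity.HubbardSuperconductivity.Theorems.FunctionFieldCertificate

open Matrix Finset Filter
open Literature.Probability.LatticeModels Literature.MathematicalPhysics.QuantumLattice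
open Summit.HubbardSuperconductivity.HubbardSuperconductivity.Theorems.MesoscopicPairOrder.Negative
  (localPair_mulVec_single_eq_zero pairNumber_rows_le exists_good_side
    boxSum_eq_zero_of_forall_localPair_eq_zero)
open scoped ComplexOrder

-- the summit namespace repeats the problem name by design (D-0017)
set_option linter.dupNamespace false

/-- **`η` kills every doublon-free `↑/↓` pattern state**: for disjoint `A, B ⊆ Λ` and any signs `ε`,
`η_ε |A↑ B↓⟩ = 0` (`η = Σ_z ε_z c_{z↓} c_{z↑}` needs a doubly occupied site). [folklore] -/
theorem etaLower_mulVec_single_pairSet_eq_zero (L : ℕ) (ε : FermionTorus 2 L → ℤˣ)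
    {A B : Finset (FermionTorus 2 L)} (hAB : Disjoint A B) :
    etaLower ε *ᵥ (Pi.single (pairSet A B) (1 : ℂ) : Fock (Orb (FermionTorus 2 L))) = 0 := by
  rw [etaLower_eq_sum_holds, sum_mulVec]
  refine sum_eq_zero fun z _ => ?_
  rw [smul_mulVec]
  have hz : ¬ (orb z 1 ∈ pairSet A B ∧ orb z 0 ∈ pairSet A B) := by
    rw [Theorems.hcf_orb_mem_pairSet_iff, Theorems.hcf_orb_mem_pairSet_iff]
    simp only [Fin.isValue, one_ne_zero, false_and, false_or, true_and, zero_ne_one, or_false]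
    exact fun h => Finset.disjoint_left.1 hAB h.2 h.1
  have h0 : (annihilation (orb z 1) * annihilation (orb z 0)) *ᵥ
      (Pi.single (pairSet A B) (1 : ℂ) : Fock (Orb (FermionTorus 2 L))) = 0 := by
    convert Theorems.hcf_annihilation_mul_annihilation_mulVec_single_eq_zero _ _ _ hz using 3
  rw [h0, smul_zero]

/-- **Explicit unit local kernel states, η-annihilated.** For `2 ≤ L` and `2m + 3L ≤ L²` there is a
unit vector of the joint sector `(2m, 0)` killed by EVERY local `d`-wave pair operator `P_x` and by
Yang's `η = etaLower torusStagger`: the occupation state with the `m` `↑`-electrons on the sites of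
rank `< m` and the `m` `↓`-electrons on the sites of rank in `[m + 2L, 2m + 2L)` — two rows apart and
doublon-free (same construction as `Negative.exists_unit_localKernel_state`). [folklore] -/
theorem exists_unit_localKernel_state_eta (L : ℕ) [NeZero L] (hL : 2 ≤ L) {m : ℕ}
    (hm : 2 * m + 3 * L ≤ L ^ 2) :
    ∃ φ : Fock (Orb (FermionTorus 2 L)), φ ∈ szSector (Λ := FermionTorus 2 L) (2 * m) 0 ∧
      star φ ⬝ᵥ φ = 1 ∧ (∀ x : TorusSite 2 L, localPair dWaveFormFactor L x *ᵥ φ = 0) ∧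
        etaLower (torusStagger : FermionTorus 2 L → ℤˣ) *ᵥ φ = 0 := by
  set rank : FermionTorus 2 L → ℕ := fun x => ((finFunctionFinEquiv (ofLex x) : Fin (L ^ 2)) : ℕ)
    with hrank
  set A : Finset (FermionTorus 2 L) := univ.filter fun x => rank x < m with hA_def
  set B : Finset (FermionTorus 2 L) :=
    (univ.filter fun x => rank x < 2 * m + 2 * L) \ (univ.filter fun x => rank x < m + 2 * L) with hB_def
  have hAcard : A.card = m := by
    rw [hA_def, Theorems.hcf_card_filter_rank_lt]
    exact min_eq_right (by omega)
  have hBcard : B.card = m := by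
    rw [hB_def, card_sdiff_of_subset (fun x hx => by
      simp only [mem_filter, mem_univ, true_and] at hx ⊢; omega),
      Theorems.hcf_card_filter_rank_lt, Theorems.hcf_card_filter_rank_lt, min_eq_right (by omega),
      min_eq_right (by omega)]
    omega
  have hmemB : ∀ y, y ∈ B ↔ m + 2 * L ≤ rank y ∧ rank y < 2 * m + 2 * L := fun y => by
    rw [hB_def, Finset.mem_sdiff, Finset.mem_filter, Finset.mem_filter]
    simp only [Finset.mem_univ, true_and, not_lt]
    tauto
  have hdisj : Disjoint A B := by
    rw [Finset.disjoint_left]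
    intro y hyA hyB
    have h1 : rank y < m := by simpa [hA_def] using hyA
    have h2 := (hmemB y).1 hyB
    omega
  refine ⟨Pi.single (pairSet A B) 1, Theorems.hcf_single_pairSet_mem_szSector L A B hAcard hBcard,
    by simp, fun x => ?_, etaLower_mulVec_single_pairSet_eq_zero L torusStagger hdisj⟩
  refine localPair_mulVec_single_eq_zero L dWaveFormFactor (pairSet A B) x fun e he => ?_
  have hPA : ∀ y : TorusSite 2 L, FermionTorus.ofTorusSite y ∈ A ↔ (y 0).val + L * (y 1).val < m := by
    intro y
    simp only [hA_def, mem_filter, mem_univ, true_and, hrank]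
    rw [Theorems.hcf_rank_ofTorusSite]
  have hQB : ∀ y : TorusSite 2 L, FermionTorus.ofTorusSite y ∈ B ↔
      m + 2 * L ≤ (y 0).val + L * (y 1).val ∧ (y 0).val + L * (y 1).val < 2 * m + 2 * L := by
    intro y
    rw [hmemB]
    simp only [hrank]
    rw [Theorems.hcf_rank_ofTorusSite]
  have hsep := Theorems.hcf_rowSeparated_no_neighbours L hL hm x e he
    (fun y => FermionTorus.ofTorusSite y ∈ A) (fun y => FermionTorus.ofTorusSite y ∈ B) hPA hQB
  rw [Theorems.hcf_orb_mem_pairSet_iff, Theorems.hcf_orb_mem_pairSet_iff,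
    Theorems.hcf_orb_mem_pairSet_iff, Theorems.hcf_orb_mem_pairSet_iff]
  simp only [Fin.isValue, true_and, zero_ne_one, one_ne_zero, false_and, or_false, false_or]
  exact hsep

/-- **At every `δ ∈ (0, 1/2)` and every even side with `3 ≤ δL` the route's sector contains an
η-annihilated unit vector with `T_R = 0` at all scales.** [folklore] -/
theorem exists_unit_sector_state_eta_boxSum_eq_zero {δ : ℝ} (hδ : δ ∈ Set.Ioo (0:ℝ) (1 / 2))
    (L : ℕ) [NeZero L] (hL : 2 ≤ L) (hδL : 3 ≤ δ * L) :
    ∃ φ : Fock (Orb (FermionTorus 2 L)),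
      φ ∈ szSector (Λ := FermionTorus 2 L) (2 * ⌊(1 - δ) * (L : ℝ) ^ 2 / 2⌋₊) 0 ∧
        star φ ⬝ᵥ φ = 1 ∧ etaLower (torusStagger : FermionTorus 2 L → ℤˣ) *ᵥ φ = 0 ∧
          ∀ R : ℕ, (∑ x : TorusSite 2 L, ∑ y : TorusSite 2 L,
              (∏ i : Fin 2, max 0 (1 - |(((y i - x i).valMinAbs : ℤ) : ℝ)| / (R : ℝ))) *
                (star (localPair dWaveFormFactor L x *ᵥ φ) ⬝ᵥ (localPair dWaveFormFactor L y *ᵥ φ)).re) = 0 := by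
  obtain ⟨φ, hφS, hφ1, hφ0, hφη⟩ := exists_unit_localKernel_state_eta L hL
    (pairNumber_rows_le L (by linarith [hδ.2]) hδL)
  exact ⟨φ, hφS, hφ1, hφη, fun R => boxSum_eq_zero_of_forall_localPair_eq_zero L R hφ0⟩

/-- **η-annihilation does not replace minimality.** The signature of the line's load-bearing stub
`stub_etaCornerOrder` with "normalised GROUND STATE of the sector" weakened to "unit vector of the
sector" — the η clause `etaLower torusStagger *ᵥ ψ = 0` KEPT, and the parameter range even widened
from the η-corner to all `U > 0`, `δ ∈ (0, 1/2)` — is FALSE: at every `(U, δ)`, every margin and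
every scale `R ≥ 1`, the doublon-free row-separated `↑/↓` state of the sector passes the η clause and
has `T_R = 0`. [folklore] -/
theorem etaCornerBody_false_without_groundState :
    ¬ (∃ U : ℝ, 0 < U ∧ ∃ δ ∈ Set.Ioo (0:ℝ) (1 / 2), ∃ m : ℝ, 0 < m ∧ ∀ R₀ : ℕ, ∃ R : ℕ, R₀ ≤ R ∧
        ∃ L₀ : ℕ, ∀ (L : ℕ) [NeZero L], L₀ ≤ L → Even L →
          ∀ ψ : Fock (Orb (FermionTorus 2 L)), star ψ ⬝ᵥ ψ = 1 →
            ψ ∈ szSector (Λ := FermionTorus 2 L) (2 * ⌊(1 - δ) * (L : ℝ) ^ 2 / 2⌋₊) 0 →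
              etaLower (torusStagger : FermionTorus 2 L → ℤˣ) *ᵥ ψ = 0 →
                m * (R : ℝ) ^ 2 ≤ (∑ x : TorusSite 2 L, ∑ y : TorusSite 2 L,
                    (∏ i : Fin 2, max 0 (1 - |(((y i - x i).valMinAbs : ℤ) : ℝ)| / (R : ℝ))) *
                      (star (localPair dWaveFormFactor L x *ᵥ ψ) ⬝ᵥ
                        (localPair dWaveFormFactor L y *ᵥ ψ)).re) / (L : ℝ) ^ 2) := by
  rintro ⟨U, -, δ, hδ, m, hm, h⟩
  obtain ⟨R, hR, L₀, hL⟩ := h 1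
  obtain ⟨L, hL₀, hEven, hL2, hδL⟩ := exists_good_side L₀ hδ.1
  haveI : NeZero L := ⟨by omega⟩
  obtain ⟨φ, hφS, hφ1, hφη, hφ0⟩ := exists_unit_sector_state_eta_boxSum_eq_zero hδ L hL2 hδL
  have hbad := hL L hL₀ hEven φ hφ1 hφS hφη
  rw [hφ0 R, zero_div] at hbad
  have hRpos : (1 : ℝ) ≤ R := by exact_mod_cast hR
  have hR2 : (1 : ℝ) ≤ (R : ℝ) ^ 2 := by nlinarith
  have hmR : m ≤ m * (R : ℝ) ^ 2 := le_mul_of_one_le_right hm.le hR2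
  linarith

/-- **Corollary in the stub's own range**: the same failure inside the η-corner
`δ ∈ (1/3, 1/2)`, `U > 8(1-δ)/(3δ-1)` (the stub's signature with the ground-state clause weakened to
sector membership). [folklore] -/
theorem etaCornerBody_false_without_groundState_corner :
    ¬ (∃ U : ℝ, 0 < U ∧ ∃ δ ∈ Set.Ioo (1 / 3 : ℝ) (1 / 2), 8 * (1 - δ) / (3 * δ - 1) < U ∧
        ∃ m : ℝ, 0 < m ∧ ∀ R₀ : ℕ, ∃ R : ℕ, R₀ ≤ R ∧
        ∃ L₀ : ℕ, ∀ (L : ℕ) [NeZero L], L₀ ≤ L → Even L →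
          ∀ ψ : Fock (Orb (FermionTorus 2 L)), star ψ ⬝ᵥ ψ = 1 →
            ψ ∈ szSector (Λ := FermionTorus 2 L) (2 * ⌊(1 - δ) * (L : ℝ) ^ 2 / 2⌋₊) 0 →
              etaLower (torusStagger : FermionTorus 2 L → ℤˣ) *ᵥ ψ = 0 →
                m * (R : ℝ) ^ 2 ≤ (∑ x : TorusSite 2 L, ∑ y : TorusSite 2 L,
                    (∏ i : Fin 2, max 0 (1 - |(((y i - x i).valMinAbs : ℤ) : ℝ)| / (R : ℝ))) *
                      (star (localPair dWaveFormFactor L x *ᵥ ψ) ⬝ᵥ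
                        (localPair dWaveFormFactor L y *ᵥ ψ)).re) / (L : ℝ) ^ 2) := by
  rintro ⟨U, hU, δ, hδ, -, m, hm, h⟩
  exact etaCornerBody_false_without_groundState ⟨U, hU, δ, ⟨by linarith [hδ.1], hδ.2⟩, m, hm, h⟩

end Summit.HubbardSuperconductivity.HubbardSuperconductivity.Theorems.FunctionFieldCertificate
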